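import Mathlib
import Literature.NumberTheory.GaloisRepresentations.SteinbergArtinRep
import Literature.RepresentationTheory.FiniteGroups.GL2ModularPrincipalSeriesSymPow
import HarnessLib

/-!
# `SteinbergArtinDedekind.SteinbergCongruence` (stmt-Langlands-11804), part 2 of 3: `k[ℙ¹(𝔽_ℓ)] = Sym^{ℓ−1} ⊕ 𝟙`

Support lemmas for the proof of `Summit.Langlands.Langlands.Theses.SteinbergArtinDedekind.SteinbergCongruence`
(part 3, `SteinbergArtinDedekindSteinbergCongruence.lean`).
§A: the matrix of the tree's permutation representation `permRep R G X` (SteinbergArtinRep) in the basis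
`(e_x)`: entries `[g • j = i]`, base change, `g⁻¹ ↦ transpose`, `tr N(g)^m = #Fix(g^m)`.
§D: over a field `k ⊇ 𝔽_ℓ`, evaluation of binary forms of degree `ℓ − 1` on lines,
`Ψ : Sym^{ℓ−1} k² → k[ℙ¹(𝔽_ℓ)]`, `Ψ(F)(L) = F(L)` (well defined since `c^{ℓ−1} = 1` on `𝔽_ℓˣ`), is injective
(a form of degree `ℓ − 1` vanishing at the `ℓ` points `(t:1)` is `0`), intertwines `x⁻¹` on `k[ℙ¹]` with
`Sym^{ℓ−1}((ιx)ᵀ)`, and lands in the augmentation kernel (`∑_L F(L) = 0`), while `ε(𝟙) = ℓ + 1 = 1 ≠ 0`: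
hence for ANY basis `bs` of `Sym^{ℓ−1} k²` there is a basis of `k[ℙ¹(𝔽_ℓ)]` in which `x⁻¹` is the block
matrix `[bs-matrix of Sym^{ℓ−1}((ιx)ᵀ)] ⊕ 1` — the special (trivial) constituent split off the generic one.
Theorems only; no `sorry`; axioms `propext`, `Classical.choice`, `Quot.sound`.
-/

set_option linter.dupNamespace false -- project-wide option; `Summit.Langlands.Langlands.Theorems` is the mandated namespace, one namespace for the three parts

namespace Summit.Langlands.Langlands.Theorems.SteinbergArtinDedekindSteinbergCongruence

open Polynomial Matrix
open Literature.NumberTheory.GaloisRepresentations (permRep permRep_single augmentation trace_permRep)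

/-! ### A. Permutation matrices of a finite `G`-set (any coefficient ring) -/

section PermMatrix

variable {R S : Type*} [CommRing R] [CommRing S] {G : Type*} [Group G] {X : Type*} [Fintype X]
  [DecidableEq X] [MulAction G X]

/-- Matrix entries of the permutation representation in the basis `(e_x)`: `[g • j = i]`. [folklore] -/
theorem toMatrix_permRep_apply (g : G) (i j : X) :
    LinearMap.toMatrix Finsupp.basisSingleOne Finsupp.basisSingleOne (permRep R G X g) i j =
      if g • j = i then 1 else 0 := by
  rw [LinearMap.toMatrix_apply, Finsupp.coe_basisSingleOne, permRep_single, Finsupp.basisSingleOne_repr,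
    LinearEquiv.refl_apply, Finsupp.single_apply]

/-- The permutation matrix is defined over `ℤ`: it is compatible with any ring map. [folklore] -/
theorem toMatrix_permRep_map (f : R →+* S) (g : G) :
    (LinearMap.toMatrix Finsupp.basisSingleOne Finsupp.basisSingleOne (permRep R G X g)).map f =
      LinearMap.toMatrix Finsupp.basisSingleOne Finsupp.basisSingleOne (permRep S G X g) := by
  ext i j
  rw [map_apply, toMatrix_permRep_apply, toMatrix_permRep_apply]
  split_ifs <;> simp

/-- The permutation matrix of `g⁻¹` is the transpose of that of `g`. [folklore] -/
theorem toMatrix_permRep_inv (g : G) :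
    LinearMap.toMatrix Finsupp.basisSingleOne Finsupp.basisSingleOne (permRep R G X g⁻¹) =
      (LinearMap.toMatrix Finsupp.basisSingleOne Finsupp.basisSingleOne (permRep R G X g))ᵀ := by
  ext i j
  rw [transpose_apply, toMatrix_permRep_apply, toMatrix_permRep_apply]
  refine if_congr ?_ rfl rfl
  rw [inv_smul_eq_iff, eq_comm]

/-- `tr (P_g ^ m) = #Fix(g ^ m)`. [folklore] -/
theorem trace_toMatrix_permRep_pow (g : G) (m : ℕ) :
    ((LinearMap.toMatrix Finsupp.basisSingleOne Finsupp.basisSingleOne (permRep R G X g)) ^ m).trace =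
      (Nat.card {x : X // g ^ m • x = x} : R) := by
  rw [LinearMap.toMatrix_pow, ← map_pow, ← LinearMap.trace_eq_matrix_trace, trace_permRep]

omit [Fintype X] [DecidableEq X] in
/-- `(g · f)(x) = f(g⁻¹ x)` for the permutation representation on `X →₀ R`. [folklore] -/
theorem permRep_apply (g : G) (f : X →₀ R) (x : X) : permRep R G X g f x = f (g⁻¹ • x) := by
  change Finsupp.lmapDomain R R (fun y : X => g • y) f x = _
  rw [Finsupp.lmapDomain_apply]
  conv_lhs => rw [← smul_inv_smul g x]
  exact Finsupp.mapDomain_apply (MulAction.injective g) f (g⁻¹ • x)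

omit [DecidableEq X] in
/-- The augmentation is the sum of the coordinates. [folklore] -/
theorem augmentation_eq_sum (f : X →₀ R) : augmentation R X f = ∑ x, f x := by
  change Finsupp.linearCombination R (fun _ : X => (1 : R)) f = _
  rw [Finsupp.linearCombination_apply, Finsupp.sum_fintype]
  · simp
  · intro _; simp

end PermMatrix

/-! ### D. The projective line `ℙ¹(𝔽_ℓ)`: evaluation of binary forms of degree `ℓ − 1` on lines

Over a field `k ⊇ 𝔽_ℓ`, `F ↦ (L ↦ F(L))` (well defined on lines because `c^{ℓ−1} = 1` on `𝔽_ℓˣ`) embeds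
`Sym^{ℓ−1} k²` `GL₂(𝔽_ℓ)`-equivariantly into `k[ℙ¹(𝔽_ℓ)]`, with image inside the augmentation kernel. -/

section ProjectiveLine

open scoped LinearAlgebra.Projectivization
open Literature.RepresentationTheory

variable {ℓ : ℕ} [Fact ℓ.Prime] {k : Type*} [Field k] [Algebra (ZMod ℓ) k]

/-- The action of `GL₂` on column vectors is `mulVec`. [folklore] -/
theorem generalLinearGroup_smul_eq_mulVec (x : GL (Fin 2) (ZMod ℓ)) (v : Fin 2 → ZMod ℓ) :
    x • v = (x : Matrix (Fin 2) (Fin 2) (ZMod ℓ)) *ᵥ v := rfl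

/-- A form of degree `ℓ − 1` takes the same value on `v` and on `c • v`, `c ∈ 𝔽_ℓˣ` (`c^{ℓ−1} = 1`).
[folklore] -/
theorem eval_comp_smul (F : MvPolynomial.homogeneousSubmodule (Fin 2) k (ℓ - 1)) (c : ZMod ℓ) (hc : c ≠ 0)
    (v : Fin 2 → ZMod ℓ) :
    MvPolynomial.eval (algebraMap (ZMod ℓ) k ∘ (c • v)) (F : MvPolynomial (Fin 2) k) =
      MvPolynomial.eval (algebraMap (ZMod ℓ) k ∘ v) (F : MvPolynomial (Fin 2) k) := by
  have : (algebraMap (ZMod ℓ) k ∘ (c • v)) = algebraMap (ZMod ℓ) k c • (algebraMap (ZMod ℓ) k ∘ v) := by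
    funext i
    simp [Pi.smul_apply, smul_eq_mul, map_mul]
  rw [this, FiniteGroups.GL2.eval_smul_of_mem_homogeneousSubmodule F.2, ← map_pow,
    ZMod.pow_card_sub_one_eq_one hc, map_one, one_mul]

/-- A form of degree `ℓ − 1` has a well-defined value on a line: `F(rep [v]) = F(v)`. [folklore] -/
theorem eval_comp_rep_mk (F : MvPolynomial.homogeneousSubmodule (Fin 2) k (ℓ - 1)) (v : Fin 2 → ZMod ℓ)
    (hv : v ≠ 0) :
    MvPolynomial.eval (algebraMap (ZMod ℓ) k ∘ (Projectivization.mk (ZMod ℓ) v hv).rep)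
        (F : MvPolynomial (Fin 2) k) =
      MvPolynomial.eval (algebraMap (ZMod ℓ) k ∘ v) (F : MvPolynomial (Fin 2) k) := by
  obtain ⟨c, hc⟩ := Projectivization.exists_smul_eq_mk_rep (ZMod ℓ) v hv
  rw [← hc, Units.smul_def]
  exact eval_comp_smul F c c.ne_zero v

/-- **The evaluation map** `Ψ : Sym^{ℓ−1} k² → k[ℙ¹(𝔽_ℓ)]`, `Ψ(F)(L) = F(L)` (a linear map). [folklore] -/
theorem exists_evalMap [Fintype (ℙ (ZMod ℓ) (Fin 2 → ZMod ℓ))] :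
    ∃ Ψ : MvPolynomial.homogeneousSubmodule (Fin 2) k (ℓ - 1) →ₗ[k] (ℙ (ZMod ℓ) (Fin 2 → ZMod ℓ) →₀ k),
      ∀ (F : MvPolynomial.homogeneousSubmodule (Fin 2) k (ℓ - 1)) (L : ℙ (ZMod ℓ) (Fin 2 → ZMod ℓ)),
        Ψ F L = MvPolynomial.eval (algebraMap (ZMod ℓ) k ∘ L.rep) (F : MvPolynomial (Fin 2) k) := by
  refine ⟨{ toFun := fun F => Finsupp.equivFunOnFinite.symm fun L =>
              MvPolynomial.eval (algebraMap (ZMod ℓ) k ∘ L.rep) (F : MvPolynomial (Fin 2) k)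
            map_add' := fun F F' => by
              ext L
              simp only [Submodule.coe_add, map_add, Finsupp.coe_equivFunOnFinite_symm, Finsupp.coe_add,
                Pi.add_apply]
            map_smul' := fun c F => by
              ext L
              simp only [Submodule.coe_smul, MvPolynomial.smul_eval, Finsupp.coe_equivFunOnFinite_symm,
                Finsupp.coe_smul, Pi.smul_apply, smul_eq_mul, RingHom.id_apply] }, fun F L => ?_⟩
  simp only [LinearMap.coe_mk, AddHom.coe_mk, Finsupp.coe_equivFunOnFinite_symm]

/-- **Equivariance**: `x⁻¹ · Ψ(F) = Ψ(Sym^{ℓ−1}((xᵀ)) F)` — precisely, with the permutation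
representation `(g·f)(L) = f(g⁻¹ L)` and the substitution action `F ↦ F(X · M)`, the matrix is
`M = (ι x)ᵀ`. [folklore] -/
theorem permRep_inv_evalMap [Fintype (ℙ (ZMod ℓ) (Fin 2 → ZMod ℓ))]
    (Ψ : MvPolynomial.homogeneousSubmodule (Fin 2) k (ℓ - 1) →ₗ[k] (ℙ (ZMod ℓ) (Fin 2 → ZMod ℓ) →₀ k))
    (hΨ : ∀ (F : MvPolynomial.homogeneousSubmodule (Fin 2) k (ℓ - 1)) (L : ℙ (ZMod ℓ) (Fin 2 → ZMod ℓ)),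
      Ψ F L = MvPolynomial.eval (algebraMap (ZMod ℓ) k ∘ L.rep) (F : MvPolynomial (Fin 2) k))
    (x : GL (Fin 2) (ZMod ℓ)) (F : MvPolynomial.homogeneousSubmodule (Fin 2) k (ℓ - 1)) :
    permRep k (GL (Fin 2) (ZMod ℓ)) (ℙ (ZMod ℓ) (Fin 2 → ZMod ℓ)) x⁻¹ (Ψ F) =
      Ψ (symPow (ℓ - 1) (((x : Matrix (Fin 2) (Fin 2) (ZMod ℓ)).map (algebraMap (ZMod ℓ) k))ᵀ) F) := by
  ext L
  rw [permRep_apply, inv_inv, hΨ, hΨ, coe_symPow_apply, FiniteGroups.GL2.eval_mvPolynomialSubst,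
    Matrix.vecMul_transpose]
  have hne : (x : Matrix (Fin 2) (Fin 2) (ZMod ℓ)) *ᵥ L.rep ≠ 0 := by
    rw [← generalLinearGroup_smul_eq_mulVec]
    exact (smul_ne_zero_iff_ne x).mpr L.rep_nonzero
  have hxL : x • L = Projectivization.mk (ZMod ℓ) ((x : Matrix (Fin 2) (Fin 2) (ZMod ℓ)) *ᵥ L.rep) hne := by
    conv_lhs => rw [← L.mk_rep]
    rw [Projectivization.smul_mk]
    rfl
  rw [hxL, eval_comp_rep_mk]
  have hfun : ((x : Matrix (Fin 2) (Fin 2) (ZMod ℓ)).map (algebraMap (ZMod ℓ) k)) *ᵥ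
      (algebraMap (ZMod ℓ) k ∘ L.rep) =
        algebraMap (ZMod ℓ) k ∘ ((x : Matrix (Fin 2) (Fin 2) (ZMod ℓ)) *ᵥ L.rep) := by
    funext i
    exact (RingHom.map_mulVec (algebraMap (ZMod ℓ) k) (x : Matrix (Fin 2) (Fin 2) (ZMod ℓ)) L.rep i).symm
  rw [hfun]

/-- **`Ψ` is injective**: a form of degree `ℓ − 1` vanishing at the `ℓ` points `(t : 1)` is zero.
[folklore] -/
theorem evalMap_injective [Fintype (ℙ (ZMod ℓ) (Fin 2 → ZMod ℓ))]
    (Ψ : MvPolynomial.homogeneousSubmodule (Fin 2) k (ℓ - 1) →ₗ[k] (ℙ (ZMod ℓ) (Fin 2 → ZMod ℓ) →₀ k))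
    (hΨ : ∀ (F : MvPolynomial.homogeneousSubmodule (Fin 2) k (ℓ - 1)) (L : ℙ (ZMod ℓ) (Fin 2 → ZMod ℓ)),
      Ψ F L = MvPolynomial.eval (algebraMap (ZMod ℓ) k ∘ L.rep) (F : MvPolynomial (Fin 2) k)) :
    Function.Injective Ψ := by
  rw [injective_iff_map_eq_zero]
  intro F hF
  have hval : ∀ t : ZMod ℓ, Polynomial.eval (algebraMap (ZMod ℓ) k t) (dehom₀ (F : MvPolynomial (Fin 2) k)) = 0 := by
    intro t
    have hv : (![t, 1] : Fin 2 → ZMod ℓ) ≠ 0 := by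
      intro h
      have := congrFun h 1
      simp at this
    have h1 := hΨ F (Projectivization.mk (ZMod ℓ) ![t, 1] hv)
    rw [hF, Finsupp.zero_apply, eval_comp_rep_mk] at h1
    have hfun : (algebraMap (ZMod ℓ) k ∘ ![t, 1]) = ![algebraMap (ZMod ℓ) k t, 1] := by
      funext i
      fin_cases i <;> simp
    rw [FiniteGroups.GL2.eval_dehom₀, ← hfun]
    exact h1.symm
  have hlt : (ℓ - 1) < Fintype.card (ZMod ℓ) := by
    rw [ZMod.card]
    exact Nat.sub_lt (Fact.out : ℓ.Prime).pos Nat.one_pos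
  have h0 : dehom₀ (F : MvPolynomial (Fin 2) k) = 0 :=
    Polynomial.eq_zero_of_natDegree_lt_card_of_eval_eq_zero _ (algebraMap (ZMod ℓ) k).injective hval
      ((natDegree_dehom₀_le F.2).trans_lt hlt)
  exact Subtype.ext (eq_zero_of_dehom₀_eq_zero F.2 h0)

/-- The sum of a form of degree `ℓ − 1 ≥ 1` over ALL points of the plane `𝔽_ℓ²` vanishes: every monomial
`X₀^{d₀} X₁^{d₁}` with `d₀ + d₁ = ℓ − 1` has an exponent `< ℓ − 1`, and `∑_{s ∈ 𝔽_ℓ} s^d = 0` for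
`d < ℓ − 1`. [folklore] -/
theorem sum_plane_eval_eq_zero (F : MvPolynomial.homogeneousSubmodule (Fin 2) k (ℓ - 1)) :
    ∑ v : Fin 2 → ZMod ℓ, MvPolynomial.eval (algebraMap (ZMod ℓ) k ∘ v) (F : MvPolynomial (Fin 2) k) = 0 := by
  have hℓ : 2 ≤ ℓ := (Fact.out : ℓ.Prime).two_le
  simp_rw [MvPolynomial.eval_eq']
  rw [Finset.sum_comm]
  refine Finset.sum_eq_zero fun d hd => ?_
  rw [← Finset.mul_sum]
  -- exponents
  have hdeg : d 0 + d 1 = ℓ - 1 := by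
    have h := (F.2.degree_eq_sum_deg_support hd).symm
    rw [Finset.sum_subset (Finset.subset_univ d.support)
      (fun i _ hi => Finsupp.notMem_support_iff.mp hi), Fin.sum_univ_two] at h
    exact h
  obtain ⟨i, hi⟩ : ∃ i : Fin 2, d i < ℓ - 1 := by
    by_cases h0 : d 0 < ℓ - 1
    · exact ⟨0, h0⟩
    · exact ⟨1, by omega⟩
  have hpow : ∑ s : ZMod ℓ, (algebraMap (ZMod ℓ) k s) ^ (d i) = 0 := by
    have h := FiniteField.sum_pow_lt_card_sub_one (K := ZMod ℓ) (d i) (by rwa [ZMod.card])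
    have h' := congrArg (algebraMap (ZMod ℓ) k) h
    rw [map_sum, map_zero] at h'
    simpa only [map_pow] using h'
  have key : ∑ v : Fin 2 → ZMod ℓ, ∏ j, (algebraMap (ZMod ℓ) k (v j)) ^ d j = 0 := by
    have h := Fintype.prod_sum (fun (j : Fin 2) (s : ZMod ℓ) => (algebraMap (ZMod ℓ) k s) ^ d j)
    beta_reduce at h
    rw [← h]
    exact Finset.prod_eq_zero (Finset.mem_univ i) hpow
  have key' : (∑ v : Fin 2 → ZMod ℓ, ∏ j, ((algebraMap (ZMod ℓ) k ∘ v) j) ^ d j) = 0 := key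
  first
    | rw [key, mul_zero]
    | rw [key', mul_zero]


/-- **The lines average out**: `∑_{L ∈ ℙ¹(𝔽_ℓ)} F(L) = 0` for a form of degree `ℓ − 1` — the nonzero
vectors fibre over the lines with fibres `𝔽_ℓˣ` of size `ℓ − 1 ≡ −1`, `F(0) = 0`, and the plane sum vanishes.
[folklore] -/
theorem sum_lines_eval_eq_zero [Fintype (ℙ (ZMod ℓ) (Fin 2 → ZMod ℓ))]
    (F : MvPolynomial.homogeneousSubmodule (Fin 2) k (ℓ - 1)) :
    ∑ L : ℙ (ZMod ℓ) (Fin 2 → ZMod ℓ),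
      MvPolynomial.eval (algebraMap (ZMod ℓ) k ∘ L.rep) (F : MvPolynomial (Fin 2) k) = 0 := by
  classical
  have hℓ : 2 ≤ ℓ := (Fact.out : ℓ.Prime).two_le
  -- the bijection `(L, c) ↦ c • rep L` onto the non-zero vectors
  have hbij : Function.Bijective (fun p : ℙ (ZMod ℓ) (Fin 2 → ZMod ℓ) × (ZMod ℓ)ˣ =>
      (⟨(p.2 : ZMod ℓ) • p.1.rep, smul_ne_zero p.2.ne_zero p.1.rep_nonzero⟩ :
        {v : Fin 2 → ZMod ℓ // v ≠ 0})) := by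
    constructor
    · rintro ⟨L, a⟩ ⟨L', a'⟩ h
      simp only [Subtype.mk.injEq] at h
      have hLL' : L = L' := by
        rw [← L.mk_rep, ← L'.mk_rep, Projectivization.mk_eq_mk_iff]
        refine ⟨a⁻¹ * a', ?_⟩
        rw [mul_smul, Units.smul_def a', ← h, ← Units.smul_def, inv_smul_smul]
      subst hLL'
      have haa' : a = a' := Units.ext (smul_left_injective (ZMod ℓ) L.rep_nonzero h)
      subst haa'
      rfl
    · rintro ⟨w, hw⟩
      obtain ⟨c, hc⟩ := Projectivization.exists_smul_eq_mk_rep (ZMod ℓ) w hw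
      refine ⟨(Projectivization.mk (ZMod ℓ) w hw, c⁻¹), Subtype.ext ?_⟩
      change ((c⁻¹ : (ZMod ℓ)ˣ) : ZMod ℓ) • (Projectivization.mk (ZMod ℓ) w hw).rep = w
      rw [← hc, ← Units.smul_def, inv_smul_smul]
  -- sum over the non-zero vectors = (ℓ − 1) • sum over the lines
  have hsum_ne : ∑ v ∈ (Finset.univ.erase (0 : Fin 2 → ZMod ℓ)),
      MvPolynomial.eval (algebraMap (ZMod ℓ) k ∘ v) (F : MvPolynomial (Fin 2) k) =
        (ℓ - 1) • ∑ L : ℙ (ZMod ℓ) (Fin 2 → ZMod ℓ),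
          MvPolynomial.eval (algebraMap (ZMod ℓ) k ∘ L.rep) (F : MvPolynomial (Fin 2) k) := by
    rw [Finset.sum_subtype (Finset.univ.erase (0 : Fin 2 → ZMod ℓ)) (p := fun v => v ≠ 0) (by simp),
      ← Fintype.sum_bijective _ hbij
        (fun p => MvPolynomial.eval (algebraMap (ZMod ℓ) k ∘ p.1.rep) (F : MvPolynomial (Fin 2) k))
        (fun v => MvPolynomial.eval (algebraMap (ZMod ℓ) k ∘ (v : Fin 2 → ZMod ℓ)) (F : MvPolynomial (Fin 2) k))
        (fun p => (eval_comp_smul F (p.2 : ZMod ℓ) p.2.ne_zero p.1.rep).symm),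
      Fintype.sum_prod_type]
    simp only [Finset.sum_const, Finset.card_univ, ZMod.card_units ℓ]
    rw [← Finset.smul_sum]
  -- F(0) = 0
  have h0 : MvPolynomial.eval (algebraMap (ZMod ℓ) k ∘ (0 : Fin 2 → ZMod ℓ)) (F : MvPolynomial (Fin 2) k) = 0 := by
    have : (algebraMap (ZMod ℓ) k ∘ (0 : Fin 2 → ZMod ℓ)) = (0 : k) • (0 : Fin 2 → k) := by
      funext i; simp
    rw [this, FiniteGroups.GL2.eval_smul_of_mem_homogeneousSubmodule F.2, zero_pow (by omega), zero_mul]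
  -- the plane sum
  have htot := sum_plane_eval_eq_zero F
  rw [← Finset.add_sum_erase Finset.univ _ (Finset.mem_univ (0 : Fin 2 → ZMod ℓ)), h0, zero_add, hsum_ne,
    nsmul_eq_mul] at htot
  have hℓk : (ℓ : k) = 0 := by
    rw [← map_natCast (algebraMap (ZMod ℓ) k), ZMod.natCast_self, map_zero]
  have hne : ((ℓ - 1 : ℕ) : k) ≠ 0 := by
    rw [Nat.cast_sub (by omega), Nat.cast_one, hℓk, zero_sub]
    exact neg_ne_zero.mpr one_ne_zero
  exact (mul_eq_zero.mp htot).resolve_left hne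

/-- `#ℙ¹(𝔽_ℓ) = ℓ + 1`. [folklore] -/
theorem card_projectiveLine [Fintype (ℙ (ZMod ℓ) (Fin 2 → ZMod ℓ))] :
    Fintype.card (ℙ (ZMod ℓ) (Fin 2 → ZMod ℓ)) = ℓ + 1 := by
  rw [← Nat.card_eq_fintype_card, Literature.NumberTheory.GaloisRepresentations.nat_card_projectiveLine,
    Nat.card_zmod]

/-- **The block decomposition `k[ℙ¹(𝔽_ℓ)] = Ψ(Sym^{ℓ−1}) ⊕ k·𝟙`** (as a `GL₂(𝔽_ℓ)`-module, `char k = ℓ`):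
in the basis `(Ψ(m_j))_j, 𝟙` the permutation action of `x⁻¹` is block-diagonal with blocks
`Sym^{ℓ−1}((ι x)ᵀ)` and `1`. [cite: Humphreys2005, §19.2 p.198] -/
theorem exists_basis_toMatrix_permRep_eq_fromBlocks [Fintype (ℙ (ZMod ℓ) (Fin 2 → ZMod ℓ))]
    [DecidableEq (ℙ (ZMod ℓ) (Fin 2 → ZMod ℓ))] (x : GL (Fin 2) (ZMod ℓ))
    (bs : Module.Basis (Fin (ℓ - 1 + 1)) k (MvPolynomial.homogeneousSubmodule (Fin 2) k (ℓ - 1))) :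
    ∃ B : Module.Basis (Fin (ℓ - 1 + 1) ⊕ Unit) k (ℙ (ZMod ℓ) (Fin 2 → ZMod ℓ) →₀ k),
      LinearMap.toMatrix B B (permRep k (GL (Fin 2) (ZMod ℓ)) (ℙ (ZMod ℓ) (Fin 2 → ZMod ℓ)) x⁻¹) =
        Matrix.fromBlocks (LinearMap.toMatrix bs bs
          (symPow (ℓ - 1) (((x : Matrix (Fin 2) (Fin 2) (ZMod ℓ)).map (algebraMap (ZMod ℓ) k))ᵀ))) 0 0 1 := by
  have hℓ : 2 ≤ ℓ := (Fact.out : ℓ.Prime).two_le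
  obtain ⟨Ψ, hΨ⟩ := exists_evalMap (k := k) (ℓ := ℓ)
  have hℓk : (ℓ : k) = 0 := by
    rw [← map_natCast (algebraMap (ZMod ℓ) k), ZMod.natCast_self, map_zero]
  -- the constant function and the augmentation
  obtain ⟨one, hone⟩ : ∃ one : ℙ (ZMod ℓ) (Fin 2 → ZMod ℓ) →₀ k, ∀ L, one L = 1 :=
    ⟨Finsupp.equivFunOnFinite.symm fun _ => 1, fun L => by simp⟩
  have hL0 : (![1, 0] : Fin 2 → ZMod ℓ) ≠ 0 := by
    intro h
    have := congrFun h 0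
    simp at this
  have hone_ne : one ≠ 0 := by
    intro h
    have := DFunLike.congr_fun h (Projectivization.mk (ZMod ℓ) ![1, 0] hL0)
    rw [hone, Finsupp.zero_apply] at this
    exact one_ne_zero this
  have haug_one : augmentation k (ℙ (ZMod ℓ) (Fin 2 → ZMod ℓ)) one = 1 := by
    rw [augmentation_eq_sum]
    simp_rw [hone]
    rw [Finset.sum_const, Finset.card_univ, card_projectiveLine, nsmul_eq_mul, mul_one, Nat.cast_add,
      Nat.cast_one, hℓk, zero_add]
  have haugΨ : ∀ F, augmentation k (ℙ (ZMod ℓ) (Fin 2 → ZMod ℓ)) (Ψ F) = 0 := fun F => by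
    rw [augmentation_eq_sum]
    simp_rw [hΨ]
    exact sum_lines_eval_eq_zero F
  -- the adapted family is linearly independent, hence a basis (dimension count `ℓ + 1`)
  have hli : LinearIndependent k (Sum.elim (fun j => Ψ (bs j)) (fun _ : Unit => one)) := by
    refine LinearIndependent.sum_type ?_ ?_ ?_
    · exact bs.linearIndependent.map' Ψ (LinearMap.ker_eq_bot.mpr (evalMap_injective Ψ hΨ))
    · exact linearIndependent_unique_iff.mpr hone_ne
    · rw [Submodule.disjoint_def]
      intro f hf hf'
      rw [Set.range_const, Submodule.mem_span_singleton] at hf'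
      obtain ⟨t, rfl⟩ := hf'
      have h1 : augmentation k (ℙ (ZMod ℓ) (Fin 2 → ZMod ℓ)) (t • one) = t := by
        rw [map_smul, haug_one, smul_eq_mul, mul_one]
      have h2 : augmentation k (ℙ (ZMod ℓ) (Fin 2 → ZMod ℓ)) (t • one) = 0 := by
        have hle : Submodule.span k (Set.range fun j => Ψ (bs j)) ≤
            LinearMap.ker (augmentation k (ℙ (ZMod ℓ) (Fin 2 → ZMod ℓ))) := by
          rw [Submodule.span_le]
          rintro _ ⟨j, rfl⟩
          exact haugΨ (bs j)
        exact hle hf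
      rw [h1.symm.trans h2, zero_smul]
  have hcard : Fintype.card (Fin (ℓ - 1 + 1) ⊕ Unit) =
      Module.finrank k (ℙ (ZMod ℓ) (Fin 2 → ZMod ℓ) →₀ k) := by
    rw [Module.finrank_finsupp_self, Fintype.card_sum, Fintype.card_fin, Fintype.card_unit,
      card_projectiveLine]
    omega
  refine ⟨basisOfLinearIndependentOfCardEqFinrank hli hcard, ?_⟩
  set B := basisOfLinearIndependentOfCardEqFinrank hli hcard with hBdef
  have hB : ⇑B = Sum.elim (fun j => Ψ (bs j)) (fun _ : Unit => one) :=
    coe_basisOfLinearIndependentOfCardEqFinrank hli hcard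
  -- the action on the two blocks
  have hTone : permRep k (GL (Fin 2) (ZMod ℓ)) (ℙ (ZMod ℓ) (Fin 2 → ZMod ℓ)) x⁻¹ one = one := by
    ext L
    rw [permRep_apply, hone, hone]
  have hTΨ : ∀ j, permRep k (GL (Fin 2) (ZMod ℓ)) (ℙ (ZMod ℓ) (Fin 2 → ZMod ℓ)) x⁻¹ (Ψ (bs j)) =
      ∑ m : Fin (ℓ - 1 + 1) ⊕ Unit, Sum.elim (fun i => LinearMap.toMatrix bs bs
        (symPow (ℓ - 1) (((x : Matrix (Fin 2) (Fin 2) (ZMod ℓ)).map (algebraMap (ZMod ℓ) k))ᵀ)) i j)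
          (fun _ => (0 : k)) m • B m := by
    intro j
    rw [permRep_inv_evalMap Ψ hΨ x (bs j)]
    conv_lhs => rw [← Matrix.toLin_toMatrix bs bs (symPow (ℓ - 1)
      (((x : Matrix (Fin 2) (Fin 2) (ZMod ℓ)).map (algebraMap (ZMod ℓ) k))ᵀ)), Matrix.toLin_self]
    rw [map_sum, Fintype.sum_sum_type, hB]
    simp only [Sum.elim_inl, Sum.elim_inr, zero_smul, Finset.sum_const_zero, add_zero, map_smul]
  ext i j
  rw [LinearMap.toMatrix_apply]
  rcases j with j | u
  · rw [hB, Sum.elim_inl, hTΨ j, B.repr_sum_self]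
    rcases i with i | u'
    · rw [Sum.elim_inl, Matrix.fromBlocks_apply₁₁]
    · rw [Sum.elim_inr, Matrix.fromBlocks_apply₂₁, Matrix.zero_apply]
  · rw [hB, Sum.elim_inr, hTone]
    have : one = B (Sum.inr u) := by rw [hB, Sum.elim_inr]
    rw [this, B.repr_self]
    rcases i with i | u'
    · rw [Matrix.fromBlocks_apply₁₂, Matrix.zero_apply, Finsupp.single_apply, if_neg]
      simp
    · rw [Matrix.fromBlocks_apply₂₂, Finsupp.single_apply, Matrix.one_apply]
      simp

end ProjectiveLine

end Summit.Langlands.Langlands.Theorems.SteinbergArtinDedekindSteinbergCongruence
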